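import Mathlib.Analysis.SpecialFunctions.Complex.Log
import Mathlib.Analysis.SpecialFunctions.Pow.Real
import Mathlib.Analysis.SpecialFunctions.Pow.Continuity
import HarnessLib

/-!
# [AbsTopIII] §4, Remarks 4.5.1 and 4.5.3: the archimedean log-Frobenius chain, the
# non-existence of a universal reference model, and pathological Kummer maps

Mochizuki, *Topics in Absolute Anabelian Geometry III*, §4 "Archimedean Log-Frobenius
Compatibility", Remarks 4.5.1–4.5.3, pp. 110–112 of the author's kurims manuscript (lit key
`paper:url-5493eb38cbb7`, 164 pp.; the journal pagination is not held).  Bib key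
`MochizukiAbsTopIII2015`.  Block W2-B4 of the abc-iut cell: nodes `AbsTopIII:Rmk4.5.1(i)`,
`AbsTopIII:Rmk4.5.1(ii)`, `AbsTopIII:Rmk4.5.3(i)`–`(iv)` are typed or recorded HERE; the corollary
itself (`AbsTopIII:Cor4.5(i)`–`(v)`) and `AbsTopIII:Rmk4.5.2` are typed in
`AbsTopIII/AutHolLogFrobenius.lean` over the diagram-of-categories vocabulary of Definition 3.5.

The setting (Def 4.1 (i), (iv), pp. 101–105; those definitions are owned by
`ArchimedeanLogFrobenius.lean`, not restated): `k` a CAF ("a topological field that is isomorphic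
to the field of complex numbers", [AbsTopIII] §0 p. 25 — the tree's `IsCAF`), `k^× = k ∖ {0}`,
`k~ ↠ k^×` the universal covering of `k^×` — a topological group, with "the 'inverse' of the
exponential map" an isomorphism `log_k : k~ ⥲ k` — and, after the log-Frobenius operation, `k~`
carries the field structure transported by `log_k`, so that "`k^×_⋎` is obtained by applying the
log-Frobenius functor `𝔩𝔬𝔤` to `k^×_{⋎+1}`", i.e. `k^×_⋎ = (k~_{⋎+1})^× ↪ k~_{⋎+1}` (p. 109, p. 111).
As in `ArchimedeanLogFrobenius.lean` (where Lemma 4.4 is "stated for `k = ℂ`"), everything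
concrete below is written for the MODEL `k = ℂ`, `k~ = (ℂ, +)`, `log_k = id`, covering map
`exp : ℂ → ℂ^×`; a CAF is, by definition, isomorphic to this model as a topological field.

## What is typed, node by node

* `AbsTopIII:Rmk4.5.1(i)` (pp. 110–111) — the "output" of the observable `𝔖_log` of Cor. 4.5 (iii)
  "may be summarized intuitively in the diagram
  `… k^×_{⋎+1} ↞ k~_{⋎+1} ←↩ k^×_⋎ ↞ k~_⋎ ←↩ k^×_{⋎−1} ↞ k~_{⋎−1} …`
  — where the arrows `↞` are the natural surjections [cf. `ι_×`!]; … the arrows `←↩` are the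
  inclusions arising from the fact that `k^×_⋎` is obtained by applying the log-Frobenius functor
  `𝔩𝔬𝔤` to `k^×_{⋎+1}` [cf. `ι_log,⋎`!]".  REAL: `archCover` (`↞`), `archIncl` (`←↩`), the composite
  transfer `archTransfer = ↞ ∘ ←↩ : k^×_⋎ → k^×_{⋎+1}`, surjective and NOT injective (PROVED).
  "Finally, the incompatibility assertions of Corollary 4.5, (iv), may be thought of as a
  statement of the non-existence of some 'universal reference model' `k^×_model` that maps
  isomorphically to the various `k^×_⋎`'s in a fashion that is compatible with the various arrows
  `↞`, `←↩` of the above diagram" — PROVED (`Rmk_4_5_1_i_no_universal_reference_model`, even for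
  bare bijections of sets) from the general `not_exists_referenceModel_of_not_injective`.
* `AbsTopIII:Rmk4.5.1(ii)` (p. 111) — "Although the operation represented by the log-Frobenius
  functor is compatible with the [Aut-holomorphic] structure-orbispaces, hence with the 'software'
  constituted by the algorithms of Corollary 2.7, it is not compatible with the additive or
  multiplicative structures on the various arithmetic data involved"; concretely, in the square
  `k^× ↞ k~ ←↩ (k~)^×` over Kummer structures to `𝕏 ⥲ 𝕏'`, "the 'actions' of `k^×`, `(k~)^×` on
  `𝕏 ⥲ 𝕏'` are not strictly compatible [i.e., the diagram does not commute]" — PROVED in the model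
  (`Rmk_4_5_1_ii_square_not_commute`: with `log_k = id` the output pair has the same field and
  Kummer structure, `𝕏' = 𝕏`, and the square commutes iff `κ (exp z) = κ z` on `k^×`); the
  "loosened" compatibility "with the [Aut-]holomorphic structure" / between co-holomorphicizations
  is recorded, not typed (co-holomorphicizations live in `Coorientations.lean`).
* `AbsTopIII:Rmk4.5.3(i)` (p. 112) — "By replacing `λ^{×pf}` by `λ^∼`, `ι_× : λ^× → λ^{×pf}` by
  `ι_× : λ^∼ → λ^×`, and 'Corollary 1.10' by 'Corollary 2.7', [...] one obtains an essentially
  straightforward 'Aut-holomorphic translation' of the bi-anabelian incompatibility result given in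
  Corollary 3.7. We leave the routine details to the reader." — typed with Cor. 4.5 in
  `AutHolLogFrobenius.lean` (the bi-anabelian statement for input data with the reversed `ι_×`).
* `AbsTopIII:Rmk4.5.3(ii)` (p. 112) — "The 'general formal content' of Remarks 3.7.1, 3.7.2, 3.7.3,
  3.7.4, 3.7.5, 3.7.7, and 3.7.8 applies to the archimedean analogue of Corollary 3.7 discussed in
  (i)".  Noted (no claim of its own).
* `AbsTopIII:Rmk4.5.3(iii)` (p. 112) — "although 'the Galois group `Π`' does not appear in the
  present archimedean context, the 'functorial detachment' of such 'functorially trivial models'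
  means, for instance, that [...] the various coverings of `𝕏` involved in this elliptic
  cuspidalization algorithm functorially induce trivial coverings of `𝕏_model`, hence do not give
  rise to a functorial isomorphism of the respective 'base fields' of `𝕏`, `𝕏_model`."  Noted
  (discussion continuing Rmk. 3.7.4; no statement beyond it).
* `AbsTopIII:Rmk4.5.3(iv)` (p. 112) — "one may give an archimedean analogue of the 'pathological
  versions of the Kummer map' given in Remark 3.7.5, (ii), by composing the `k`-Kummer structure
  `κ_k : k ⥲ 𝒜_{𝕏_ell}`, restricted, say, to `k^×`, with the [non-additive!] automorphism of
  `k^× ⥲ 𝒪^×_k × ℝ_{>0}` that acts as the identity on `𝒪^×_k` and is given by raising to the `λ`-th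
  power [for some `λ ∈ ℝ_{>0}`] on `ℝ_{>0}`."  REAL: `powTwist s : ℂ^× ≃* ℂ^×` (continuous, the
  identity on the unit circle `𝒪^×_k`, `r ↦ r^s` on `ℝ_{>0}`), PROVED non-additive for `s ≠ 1`;
  the pathological Kummer map `pathologicalKummerMap κ s = κ ∘ powTwist s` for any field embedding
  `κ` of `k` (the `k`-Kummer structure of Def. 4.1 (i) is such an isomorphism onto `𝒜_𝕏`;
  `KummerStructure` in `ArchimedeanLogFrobenius.lean`), PROVED multiplicative and non-additive.

Deliberately NOT here: Cor. 4.5 and Rmk. 4.5.2 (`AutHolLogFrobenius.lean`); Def. 4.1 and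
Lemma 4.4 (`ArchimedeanLogFrobenius.lean`; its `addMulDistinguishableArch` is Lemma 4.4 with an
arbitrary topological automorphism `α` of `k^×` in front — `archTransfer_not_injective` below is the
mechanism of its proof, "the non-injectivity of `k~ ↠ k^×`", proved here in three lines so that
this file depends on Mathlib only).
-/

noncomputable section

namespace Literature.AnabelianGeometry.AbsoluteAnabelian.AbsTopIII

universe u v

/-! ### Remark 4.5.1 (i): the chain `… ↞ k~_⋎ ←↩ k^×_{⋎−1} ↞ …` in the model `k = ℂ` -/

/-- The arrows "`↞`" of the diagram of Rmk. 4.5.1 (i) ("the natural surjections [cf. `ι_×`!]"): the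
universal covering `k~ ↠ k^×` of Def. 4.1 (i) in the model `k = ℂ`, `k~ = (ℂ, +)`, i.e. the
exponential map onto the nonzero complex numbers.
[cite: MochizukiAbsTopIII2015, Remark 4.5.1 (i) p.110] -/
def archCover (z : ℂ) : ℂˣ := Units.mk0 (Complex.exp z) (Complex.exp_ne_zero z)

/-- The underlying complex number of `archCover z` is `exp z`.
[cite: MochizukiAbsTopIII2015, Remark 4.5.1 (i) p.110] -/
@[simp] theorem coe_archCover (z : ℂ) : (archCover z : ℂ) = Complex.exp z := rfl

/-- `k~ ↠ k^×` is a homomorphism from the additive group `k~` to the multiplicative group `k^×`.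
[cite: MochizukiAbsTopIII2015, Remark 4.5.1 (i) p.110] -/
theorem archCover_add (z w : ℂ) : archCover (z + w) = archCover z * archCover w := by
  ext
  simp [Complex.exp_add]

/-- `k~ ↠ k^×` is surjective ("the natural surjections").
[cite: MochizukiAbsTopIII2015, Remark 4.5.1 (i) p.110] -/
theorem archCover_surjective : Function.Surjective archCover := by
  intro w
  refine ⟨Complex.log (w : ℂ), ?_⟩
  ext
  simp [Complex.exp_log w.ne_zero]

/-- The covering map kills `2πi`.
[cite: MochizukiAbsTopIII2015, Remark 4.5.1 (i) p.110] -/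
theorem archCover_two_pi_mul_I : archCover (2 * Real.pi * Complex.I) = 1 := by
  ext
  simp

/-- The arrows "`←↩`" of the diagram of Rmk. 4.5.1 (i): `k^×_⋎ ↪ k~_{⋎+1}`, "the inclusions arising
from the fact that `k^×_⋎` is obtained by applying the log-Frobenius functor `𝔩𝔬𝔤` to `k^×_{⋎+1}`
[cf. `ι_log,⋎`!]" — in the model the field `k_⋎` is `k~_{⋎+1} = ℂ` (field structure transported by
`log_k = id`, Def. 4.1 (iv)), so this is the inclusion `ℂ^× ↪ ℂ` of the nonzero elements.
[cite: MochizukiAbsTopIII2015, Remark 4.5.1 (i) p.111] -/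
def archIncl (z : ℂˣ) : ℂ := z

/-- `k^×_⋎ ↪ k~_{⋎+1}` is injective.
[cite: MochizukiAbsTopIII2015, Remark 4.5.1 (i) p.111] -/
theorem archIncl_injective : Function.Injective archIncl := fun _ _ h => Units.ext h

/-- The transfer map `k^×_⋎ → k^×_{⋎+1}` along the chain of Rmk. 4.5.1 (i): the composite
`k^×_⋎ ↪ k~_{⋎+1} ↠ k^×_{⋎+1}` of an arrow `←↩` with the next arrow `↞`.
[cite: MochizukiAbsTopIII2015, Remark 4.5.1 (i) pp.110–111] -/
def archTransfer (z : ℂˣ) : ℂˣ := archCover (archIncl z)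

/-- The transfer map on underlying complex numbers is `z ↦ exp z`.
[cite: MochizukiAbsTopIII2015, Remark 4.5.1 (i) pp.110–111] -/
@[simp] theorem coe_archTransfer (z : ℂˣ) : (archTransfer z : ℂ) = Complex.exp z := rfl

/-- The transfer map `k^×_⋎ → k^×_{⋎+1}` is surjective (every nonzero complex number is the
exponential of a NONZERO complex number).
[cite: MochizukiAbsTopIII2015, Remark 4.5.1 (i) pp.110–111] -/
theorem archTransfer_surjective : Function.Surjective archTransfer := by
  intro w
  by_cases h : Complex.log (w : ℂ) = 0
  · -- `w = 1`: use the nonzero preimage `2πi`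
    have hw : (w : ℂ) = 1 := by
      rw [← Complex.exp_log w.ne_zero, h, Complex.exp_zero]
    refine ⟨Units.mk0 (2 * Real.pi * Complex.I) (by simp [Real.pi_ne_zero]), ?_⟩
    ext
    simp [archTransfer, archIncl, hw]
  · refine ⟨Units.mk0 (Complex.log (w : ℂ)) h, ?_⟩
    ext
    simp [archTransfer, archIncl, Complex.exp_log w.ne_zero]

/-- The transfer map `k^×_⋎ ↪ k~_{⋎+1} ↠ k^×_{⋎+1}` is NOT injective — "the non-injectivity of
`k~ ↠ k^×`" (proof of Lemma 4.4, p. 107): `2πi` and `4πi` are distinct elements of `k^×_⋎` with the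
same image `1`.
[cite: MochizukiAbsTopIII2015, Remark 4.5.1 (i) pp.110–111] -/
theorem archTransfer_not_injective : ¬ Function.Injective archTransfer := by
  intro hinj
  have hπ : (2 * Real.pi * Complex.I : ℂ) ≠ 0 := by simp [Real.pi_ne_zero]
  have h2π : (2 * (2 * Real.pi * Complex.I) : ℂ) ≠ 0 := mul_ne_zero two_ne_zero hπ
  have himage : archTransfer (Units.mk0 _ hπ) = archTransfer (Units.mk0 _ h2π) := by
    ext
    simp only [coe_archTransfer, Units.val_mk0]
    rw [Complex.exp_eq_one_iff.mpr ⟨1, by simp⟩, Complex.exp_eq_one_iff.mpr ⟨2, by push_cast; ring⟩]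
  have h := congrArg (fun z : ℂˣ => (z : ℂ)) (hinj himage)
  simp only [Units.val_mk0] at h
  exact hπ (by linear_combination -h)

/-- **No universal reference model along a chain with a non-injective transfer map** (the formal
content of the last sentence of Rmk. 4.5.1 (i), for an arbitrary chain): if objects `A i` are
linked by maps `f i : A i → A (σ i)` one of which is not injective, then there is no object `M`
with bijections `m i : M ≃ A i` compatible with the `f i` (`f i ∘ m i = m (σ i)`).
[cite: MochizukiAbsTopIII2015, Remark 4.5.1 (i) p.111] -/
theorem not_exists_referenceModel_of_not_injective {ι : Type u} {A : ι → Type v} (σ : ι → ι)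
    (f : ∀ i, A i → A (σ i)) {i₀ : ι} (hf : ¬ Function.Injective (f i₀)) :
    ¬ ∃ (M : Type v) (m : ∀ i, M ≃ A i), ∀ (i : ι) (x : M), f i (m i x) = m (σ i) x := by
  rintro ⟨M, m, hm⟩
  apply hf
  intro a b hab
  obtain ⟨x, rfl⟩ := (m i₀).surjective a
  obtain ⟨y, rfl⟩ := (m i₀).surjective b
  rw [hm, hm] at hab
  rw [(m (σ i₀)).injective hab]

/-- **Remark 4.5.1 (i)** (last sentence): "the incompatibility assertions of Corollary 4.5, (iv),
may be thought of as a statement of the non-existence of some 'universal reference model'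
`k^×_model` that maps isomorphically to the various `k^×_⋎`'s in a fashion that is compatible with
the various arrows `↞`, `←↩` of the above diagram".  PROVED in the model `k = ℂ`, in the strong
form where the `k^×_⋎ ← k^×_model` are merely bijections of sets: compatibility with the arrows
forces the transfer maps `k^×_⋎ → k^×_{⋎+1}` to be injective, contradicting
`archTransfer_not_injective`.
[cite: MochizukiAbsTopIII2015, Remark 4.5.1 (i) p.111] -/
theorem Rmk_4_5_1_i_no_universal_reference_model :
    ¬ ∃ (M : Type) (m : ℤ → M ≃ ℂˣ), ∀ (n : ℤ) (x : M), archTransfer (m n x) = m (n + 1) x :=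
  not_exists_referenceModel_of_not_injective (A := fun _ : ℤ => ℂˣ) (· + 1)
    (fun _ => archTransfer) (i₀ := 0) archTransfer_not_injective

/-! ### Remark 4.5.1 (ii): the square `k^× ↞ k~ ←↩ (k~)^×` does not commute -/

/-- **Remark 4.5.1 (ii)**: starting from `𝕏` with a Kummer structure `𝕏 ↶^κ k^×` and equipping
`k~` with its field structure via `log_k`, "although the 'actions' of `k^×`, `(k~)^×` on `𝕏 ⥲ 𝕏'`
are not strictly compatible [i.e., the diagram `k^× ↞ k~ ←↩ (k~)^×` (over `𝕏 ⥲ 𝕏'`) does not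
commute], they become 'compatible' if one 'loosens one's notion of compatibility' to the notion of
being 'compatible with the [Aut-]holomorphic structure'".  PROVED (the non-commutativity) in the
model: there `log_k = id`, the output pair of the log-Frobenius operation has the same field and
Kummer structure `κ` and `𝕏' = 𝕏` (Def. 4.1 (iv)), so the square commutes iff
`κ (↞ (←↩ z)) = κ z` for all `z ∈ (k~)^×`, which fails for ANY injective `κ` (at `z = 2πi`).
[cite: MochizukiAbsTopIII2015, Remark 4.5.1 (ii) p.111] -/
theorem Rmk_4_5_1_ii_square_not_commute {A : Type u} (κ : ℂ → A) (hκ : Function.Injective κ) :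
    ¬ ∀ z : ℂˣ, κ (archTransfer z : ℂ) = κ (z : ℂ) := by
  intro h
  have hπ : (2 * Real.pi * Complex.I : ℂ) ≠ 0 := by simp [Real.pi_ne_zero]
  have h1 := hκ (h (Units.mk0 _ hπ))
  simp only [coe_archTransfer, Units.val_mk0, Complex.exp_two_pi_mul_I] at h1
  have h2 := congrArg Complex.im h1
  simp at h2

/-! ### Remark 4.5.3 (iv): the pathological automorphism of `k^× ≅ 𝒪^×_k × ℝ_{>0}` -/

/-- The scaling factor `‖z‖^(s-1)` of `powTwist s` at `z ∈ k^×` (a positive real number).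
[cite: MochizukiAbsTopIII2015, Remark 4.5.3 (iv) p.112] -/
def powTwistFactor (s : ℝ) (z : ℂˣ) : ℝ := ‖(z : ℂ)‖ ^ (s - 1)

/-- The scaling factor is positive.
[cite: MochizukiAbsTopIII2015, Remark 4.5.3 (iv) p.112] -/
theorem powTwistFactor_pos (s : ℝ) (z : ℂˣ) : 0 < powTwistFactor s z :=
  Real.rpow_pos_of_pos (norm_pos_iff.mpr z.ne_zero) _

/-- The scaling factor is multiplicative in `z`.
[cite: MochizukiAbsTopIII2015, Remark 4.5.3 (iv) p.112] -/
theorem powTwistFactor_mul (s : ℝ) (z w : ℂˣ) :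
    powTwistFactor s (z * w) = powTwistFactor s z * powTwistFactor s w := by
  simp only [powTwistFactor, Units.val_mul, norm_mul]
  exact Real.mul_rpow (norm_nonneg _) (norm_nonneg _)

/-- The map underlying the automorphism of Rmk. 4.5.3 (iv) in the model `k = ℂ`: under the polar
decomposition `k^× ⥲ 𝒪^×_k × ℝ_{>0}`, `z = u · r ↦ u · r^s`, i.e. `z ↦ ‖z‖^(s-1) · z`.
[cite: MochizukiAbsTopIII2015, Remark 4.5.3 (iv) p.112] -/
def powTwistFun (s : ℝ) (z : ℂˣ) : ℂˣ :=
  Units.mk0 ((powTwistFactor s z : ℂ) * z)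
    (mul_ne_zero (Complex.ofReal_ne_zero.mpr (powTwistFactor_pos s z).ne') z.ne_zero)

/-- Underlying complex number of `powTwistFun s z`.
[cite: MochizukiAbsTopIII2015, Remark 4.5.3 (iv) p.112] -/
@[simp] theorem coe_powTwistFun (s : ℝ) (z : ℂˣ) :
    (powTwistFun s z : ℂ) = (powTwistFactor s z : ℂ) * z := rfl

/-- `powTwistFun s` is multiplicative.
[cite: MochizukiAbsTopIII2015, Remark 4.5.3 (iv) p.112] -/
theorem powTwistFun_mul (s : ℝ) (z w : ℂˣ) :
    powTwistFun s (z * w) = powTwistFun s z * powTwistFun s w := by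
  ext
  simp only [coe_powTwistFun, powTwistFactor_mul, Complex.ofReal_mul, Units.val_mul]
  ring

/-- The norm of `powTwistFun s z` is `‖z‖^s` ("raising to the `λ`-th power on `ℝ_{>0}`").
[cite: MochizukiAbsTopIII2015, Remark 4.5.3 (iv) p.112] -/
theorem norm_powTwistFun (s : ℝ) (z : ℂˣ) : ‖(powTwistFun s z : ℂ)‖ = ‖(z : ℂ)‖ ^ s := by
  have hz : 0 < ‖(z : ℂ)‖ := norm_pos_iff.mpr z.ne_zero
  rw [coe_powTwistFun, norm_mul, Complex.norm_of_nonneg (powTwistFactor_pos s z).le,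
    powTwistFactor]
  conv_rhs => rw [show s = (s - 1) + 1 by ring, Real.rpow_add hz, Real.rpow_one]

/-- `powTwistFun 1` is the identity.
[cite: MochizukiAbsTopIII2015, Remark 4.5.3 (iv) p.112] -/
theorem powTwistFun_one (z : ℂˣ) : powTwistFun 1 z = z := by
  ext
  simp [powTwistFactor]

/-- Composition law: `powTwistFun t ∘ powTwistFun s = powTwistFun (s * t)`.
[cite: MochizukiAbsTopIII2015, Remark 4.5.3 (iv) p.112] -/
theorem powTwistFun_powTwistFun (s t : ℝ) (z : ℂˣ) :
    powTwistFun t (powTwistFun s z) = powTwistFun (s * t) z := by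
  have hz : 0 < ‖(z : ℂ)‖ := norm_pos_iff.mpr z.ne_zero
  have hfac : powTwistFactor t (powTwistFun s z) * powTwistFactor s z =
      powTwistFactor (s * t) z := by
    simp only [powTwistFactor, norm_powTwistFun]
    rw [← Real.rpow_mul hz.le, ← Real.rpow_add hz]
    congr 1
    ring
  ext
  simp only [coe_powTwistFun]
  rw [← mul_assoc, ← Complex.ofReal_mul, hfac]

/-- **Remark 4.5.3 (iv): the automorphism of `k^× ⥲ 𝒪^×_k × ℝ_{>0}`** "that acts as the identity
on `𝒪^×_k` and is given by raising to the `λ`-th power [for some `λ ∈ ℝ_{>0}`] on `ℝ_{>0}`", in the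
model `k = ℂ`, as a group automorphism of `k^×` (for any exponent `s ≠ 0`; inverse = exponent
`s⁻¹`).
[cite: MochizukiAbsTopIII2015, Remark 4.5.3 (iv) p.112] -/
def powTwist (s : ℝ) (hs : s ≠ 0) : ℂˣ ≃* ℂˣ where
  toFun := powTwistFun s
  invFun := powTwistFun s⁻¹
  left_inv z := by rw [powTwistFun_powTwistFun, mul_inv_cancel₀ hs, powTwistFun_one]
  right_inv z := by rw [powTwistFun_powTwistFun, inv_mul_cancel₀ hs, powTwistFun_one]
  map_mul' := powTwistFun_mul s

/-- `powTwist s` is `powTwistFun s` as a function.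
[cite: MochizukiAbsTopIII2015, Remark 4.5.3 (iv) p.112] -/
@[simp] theorem powTwist_apply (s : ℝ) (hs : s ≠ 0) (z : ℂˣ) :
    powTwist s hs z = powTwistFun s z := rfl

/-- `powTwist s` "acts as the identity on `𝒪^×_k`" (the unit circle `‖z‖ = 1`).
[cite: MochizukiAbsTopIII2015, Remark 4.5.3 (iv) p.112] -/
theorem powTwistFun_of_norm_eq_one (s : ℝ) {z : ℂˣ} (hz : ‖(z : ℂ)‖ = 1) :
    powTwistFun s z = z := by
  ext
  simp [powTwistFactor, hz]

/-- `powTwist s` "is given by raising to the `λ`-th power on `ℝ_{>0}`": a positive real number `r`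
is sent to `r^s`.
[cite: MochizukiAbsTopIII2015, Remark 4.5.3 (iv) p.112] -/
theorem powTwistFun_ofReal {r : ℝ} (hr : 0 < r) (s : ℝ) :
    (powTwistFun s (Units.mk0 (r : ℂ) (Complex.ofReal_ne_zero.mpr hr.ne')) : ℂ) =
      ((r ^ s : ℝ) : ℂ) := by
  rw [coe_powTwistFun, Units.val_mk0, powTwistFactor, Units.val_mk0,
    Complex.norm_of_nonneg hr.le, ← Complex.ofReal_mul]
  congr 1
  rw [show r ^ s = r ^ ((s - 1) + 1) by ring_nf, Real.rpow_add hr, Real.rpow_one]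

/-- `powTwist s` is continuous (an automorphism of the TOPOLOGICAL group `k^×`).
[cite: MochizukiAbsTopIII2015, Remark 4.5.3 (iv) p.112] -/
theorem continuous_powTwistFun (s : ℝ) : Continuous (powTwistFun s) := by
  have hval : Continuous (fun z : ℂˣ => (powTwistFun s z : ℂ)) := by
    simp only [coe_powTwistFun, powTwistFactor]
    refine Continuous.mul ?_ Units.continuous_val
    refine Complex.continuous_ofReal.comp ?_
    refine Continuous.rpow_const (continuous_norm.comp Units.continuous_val) fun z => ?_
    exact Or.inl (norm_ne_zero_iff.mpr z.ne_zero)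
  refine Units.continuous_iff.mpr ⟨hval, ?_⟩
  simp only [Units.val_inv_eq_inv_val]
  exact hval.inv₀ fun z => (powTwistFun s z).ne_zero

/-- **Remark 4.5.3 (iv): "[non-additive!]"** — for `s ≠ 1` the automorphism `powTwist s` of `k^×`
does not respect addition: `1 + 1 = 2` in `k`, but `powTwist s 1 + powTwist s 1 = 2 ≠ 2^s =
powTwist s 2`.
[cite: MochizukiAbsTopIII2015, Remark 4.5.3 (iv) p.112] -/
theorem powTwistFun_not_additive {s : ℝ} (hs : s ≠ 1) :
    ∃ (x y : ℂˣ) (h : (x : ℂ) + y ≠ 0),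
      (powTwistFun s (Units.mk0 ((x : ℂ) + y) h) : ℂ) ≠ powTwistFun s x + powTwistFun s y := by
  have h2 : ((1 : ℂˣ) : ℂ) + (1 : ℂˣ) ≠ 0 := by norm_num
  refine ⟨1, 1, h2, ?_⟩
  have hone : (powTwistFun s 1 : ℂ) = 1 := by
    rw [powTwistFun_of_norm_eq_one s (by simp)]
    simp
  have htwo : (powTwistFun s (Units.mk0 (((1 : ℂˣ) : ℂ) + (1 : ℂˣ)) h2) : ℂ) =
      (((2 : ℝ) ^ s : ℝ) : ℂ) := by
    have h2' : (2 : ℂ) ≠ 0 := two_ne_zero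
    have : Units.mk0 (((1 : ℂˣ) : ℂ) + (1 : ℂˣ)) h2 =
        Units.mk0 ((2 : ℝ) : ℂ) (Complex.ofReal_ne_zero.mpr two_ne_zero) := by
      ext; push_cast; norm_num
    rw [this, powTwistFun_ofReal two_pos]
  rw [hone, htwo]
  norm_num
  intro h
  -- `(2 : ℝ) ^ s = 2` forces `s = 1`
  have h' : (2 : ℝ) ^ s = 2 := by exact_mod_cast h
  have hlog := congrArg Real.log h'
  rw [Real.log_rpow two_pos] at hlog
  have hlog2 : Real.log 2 ≠ 0 := (Real.log_pos one_lt_two).ne'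
  apply hs
  field_simp at hlog
  linarith [hlog]

/-- **Remark 4.5.3 (iv): the pathological Kummer map** — "composing the `k`-Kummer structure
`κ_k : k ⥲ 𝒜_{𝕏_ell}`, restricted, say, to `k^×`, with the [non-additive!] automorphism" `powTwist s`.
Typed for an arbitrary ring homomorphism `κ` out of the model field `k = ℂ` (the `k`-Kummer
structure of Def. 4.1 (i) is such an isomorphism of topological fields `k ⥲ 𝒜_𝕏`).
[cite: MochizukiAbsTopIII2015, Remark 4.5.3 (iv) p.112] -/
def pathologicalKummerMap {A : Type u} [Field A] (κ : ℂ →+* A) (s : ℝ) (z : ℂˣ) : A :=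
  κ (powTwistFun s z)

/-- The pathological Kummer map is multiplicative (it is a homomorphism on `k^×`).
[cite: MochizukiAbsTopIII2015, Remark 4.5.3 (iv) p.112] -/
theorem pathologicalKummerMap_mul {A : Type u} [Field A] (κ : ℂ →+* A) (s : ℝ) (z w : ℂˣ) :
    pathologicalKummerMap κ s (z * w) = pathologicalKummerMap κ s z * pathologicalKummerMap κ s w := by
  simp [pathologicalKummerMap, powTwistFun_mul]

/-- The pathological Kummer map is NOT additive for `s ≠ 1` (whereas the genuine Kummer structure
`κ_k|_{k^×}` is the restriction of a field isomorphism): "pathological versions of the Kummer map".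
[cite: MochizukiAbsTopIII2015, Remark 4.5.3 (iv) p.112] -/
theorem pathologicalKummerMap_not_additive {A : Type u} [Field A] (κ : ℂ →+* A) {s : ℝ}
    (hs : s ≠ 1) :
    ∃ (x y : ℂˣ) (h : (x : ℂ) + y ≠ 0),
      pathologicalKummerMap κ s (Units.mk0 ((x : ℂ) + y) h) ≠
        pathologicalKummerMap κ s x + pathologicalKummerMap κ s y := by
  obtain ⟨x, y, h, hne⟩ := powTwistFun_not_additive hs
  refine ⟨x, y, h, ?_⟩
  simp only [pathologicalKummerMap, ← map_add]
  exact fun heq => hne (κ.injective heq)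

end Literature.AnabelianGeometry.AbsoluteAnabelian.AbsTopIII
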